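import Mathlib
import Summits.PneNP.PneNP.Theorems.SfmBlMatrixToolkit
import Summits.PneNP.PneNP.Theorems.SfmBlBipartiteForm
import Summits.PneNP.PneNP.Theorems.SfmBlConnectedPairs
import Literature.Combinatorics.Expanders.DiscrepancySpectralRadius

/-!
# From connected-pair discrepancy to a trace bound — line «sfm-bl» (deterministic spine of PROOF-SFM-BL Prop. 7)

FRONTIER F-N1c; nothing here bears on P vs NP.

For a rectangular real matrix `M` (signed piece-level biadjacency of the sparse remainder) with row and column
ℓ₁-norms `≤ L`, whose discrepancy `|uᵀMv| ≤ γ√(|u||v|)` is known on CONNECTED 0/1 pairs of a graph `G`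
containing its support (`0 < γ ≤ L`), the bipartite double `A = [[0, M], [Mᵀ, 0]]` satisfies
`tr(A^{2k}) ≤ (|α|+|β|)·(100·γ·(log₂(L/γ)+1))^{2k}`.  Chain: `disc_of_connected_pairs` (all 0/1 pairs) →
`bipartite_disc_of_disc` (0/1 pairs of the double) → `BiluLinial2006.rectBound_of_forall_dotProduct`
(rectangles) → `BiluLinial2006_lemma_3_3_explicit` (Rayleigh bound, `C = 0`, constant `100`) →
`trace_pow_le_of_rayleigh`.  No eigenvalues anywhere.
-/

namespace Summit.PneNP.PneNP.Theorems.SfmBl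

open Matrix Finset BigOperators

/-- Two-term Cauchy–Schwarz with square roots: `√(ad) + √(cb) ≤ √((a+b)(c+d))`. -/
theorem sqrt_mul_add_sqrt_mul_le {a b c d : ℝ} (ha : 0 ≤ a) (hb : 0 ≤ b) (hc : 0 ≤ c) (hd : 0 ≤ d) :
    Real.sqrt (a * d) + Real.sqrt (c * b) ≤ Real.sqrt ((a + b) * (c + d)) := by
  have h := sum_sqrt_mul_le (Finset.univ : Finset Bool) (fun t => if t then a else b)
    (fun t => if t then d else c) (fun t => by cases t <;> simp [ha, hb])
    (fun t => by cases t <;> simp [hc, hd])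
  simp only [Fintype.sum_bool, if_true, Bool.false_eq_true, if_false] at h
  rw [mul_comm c b, add_comm c d]
  exact h

variable {α β : Type} [Fintype α] [Fintype β]

/-- Discrepancy of the bipartite double: if `|uᵀMv| ≤ γ√(|u||v|)` for all 0/1 pairs `(u, v)`, then
`|UᵀAW| ≤ γ√(|U||W|)` for all 0/1 vectors `U, W` on `α ⊕ β`, `A = [[0, M], [Mᵀ, 0]]`. -/
theorem bipartite_disc_of_disc (M : Matrix α β ℝ) {γ : ℝ} (hγ : 0 ≤ γ)
    (hD : ∀ (u : α → ℝ) (v : β → ℝ), (∀ i, u i = 0 ∨ u i = 1) → (∀ j, v j = 0 ∨ v j = 1) →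
      |u ⬝ᵥ (M *ᵥ v)| ≤ γ * Real.sqrt ((∑ i, u i) * (∑ j, v j)))
    (U W : α ⊕ β → ℝ) (hU : ∀ x, U x = 0 ∨ U x = 1) (hW : ∀ x, W x = 0 ∨ W x = 1) :
    |U ⬝ᵥ ((Matrix.fromBlocks (0 : Matrix α α ℝ) M Mᵀ (0 : Matrix β β ℝ)) *ᵥ W)|
      ≤ γ * Real.sqrt ((∑ x, U x) * (∑ x, W x)) := by
  set u₁ : α → ℝ := fun i => U (Sum.inl i) with hu₁
  set u₂ : β → ℝ := fun k => U (Sum.inr k) with hu₂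
  set w₁ : α → ℝ := fun i => W (Sum.inl i) with hw₁
  set w₂ : β → ℝ := fun k => W (Sum.inr k) with hw₂
  have e1 : U ⬝ᵥ ((Matrix.fromBlocks (0 : Matrix α α ℝ) M Mᵀ (0 : Matrix β β ℝ)) *ᵥ W)
      = u₁ ⬝ᵥ (M *ᵥ w₂) + u₂ ⬝ᵥ (Mᵀ *ᵥ w₁) := by
    have hWsplit : W = Sum.elim w₁ w₂ := by
      ext x; cases x <;> rfl
    have hUsplit : U = Sum.elim u₁ u₂ := by
      ext x; cases x <;> rfl
    conv_lhs => rw [hWsplit, hUsplit]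
    rw [Matrix.fromBlocks_mulVec]
    simp only [Sum.elim_comp_inl, Sum.elim_comp_inr, Matrix.zero_mulVec, zero_add, add_zero,
      sumElim_dotProduct_sumElim]
  have e2 : u₂ ⬝ᵥ (Mᵀ *ᵥ w₁) = w₁ ⬝ᵥ (M *ᵥ u₂) := by
    rw [Matrix.mulVec_transpose, dotProduct_comm, ← Matrix.dotProduct_mulVec]
  have hu₁01 : ∀ i, u₁ i = 0 ∨ u₁ i = 1 := fun i => hU _
  have hu₂01 : ∀ k, u₂ k = 0 ∨ u₂ k = 1 := fun k => hU _
  have hw₁01 : ∀ i, w₁ i = 0 ∨ w₁ i = 1 := fun i => hW _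
  have hw₂01 : ∀ k, w₂ k = 0 ∨ w₂ k = 1 := fun k => hW _
  have h1 := hD u₁ w₂ hu₁01 hw₂01
  have h2 := hD w₁ u₂ hw₁01 hu₂01
  have nn : ∀ (f : ℝ), f = 0 ∨ f = 1 → 0 ≤ f := by
    rintro f (h | h) <;> simp [h]
  have ha : 0 ≤ ∑ i, u₁ i := Finset.sum_nonneg fun i _ => nn _ (hu₁01 i)
  have hb : 0 ≤ ∑ k, u₂ k := Finset.sum_nonneg fun k _ => nn _ (hu₂01 k)
  have hc : 0 ≤ ∑ i, w₁ i := Finset.sum_nonneg fun i _ => nn _ (hw₁01 i)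
  have hd : 0 ≤ ∑ k, w₂ k := Finset.sum_nonneg fun k _ => nn _ (hw₂01 k)
  have hUsum : ∑ x, U x = ∑ i, u₁ i + ∑ k, u₂ k := Fintype.sum_sum_type U
  have hWsum : ∑ x, W x = ∑ i, w₁ i + ∑ k, w₂ k := Fintype.sum_sum_type W
  rw [e1, hUsum, hWsum]
  calc |u₁ ⬝ᵥ (M *ᵥ w₂) + u₂ ⬝ᵥ (Mᵀ *ᵥ w₁)|
      ≤ |u₁ ⬝ᵥ (M *ᵥ w₂)| + |u₂ ⬝ᵥ (Mᵀ *ᵥ w₁)| := abs_add_le _ _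
    _ = |u₁ ⬝ᵥ (M *ᵥ w₂)| + |w₁ ⬝ᵥ (M *ᵥ u₂)| := by rw [e2]
    _ ≤ γ * Real.sqrt ((∑ i, u₁ i) * (∑ k, w₂ k)) + γ * Real.sqrt ((∑ i, w₁ i) * (∑ k, u₂ k)) :=
        add_le_add h1 h2
    _ = γ * (Real.sqrt ((∑ i, u₁ i) * (∑ k, w₂ k)) + Real.sqrt ((∑ i, w₁ i) * (∑ k, u₂ k))) := by ring
    _ ≤ γ * Real.sqrt ((∑ i, u₁ i + ∑ k, u₂ k) * (∑ i, w₁ i + ∑ k, w₂ k)) :=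
        mul_le_mul_of_nonneg_left (sqrt_mul_add_sqrt_mul_le ha hb hc hd) hγ

/-- DETERMINISTIC SPINE OF PROP. 7: connected-pair discrepancy `γ` (w.r.t. any graph `G ⊇ supp M`), row and
column ℓ₁-norms `≤ L`, `0 < γ ≤ L` ⇒ `tr(A^{2k}) ≤ (|α|+|β|)·(100·γ·(log₂(L/γ)+1))^{2k}` for the bipartite
double `A` of `M` (Bilu–Linial Lemma 3.3 with the tree's constant `100`, then the trace of an even power). -/
theorem trace_pow_le_of_connected_disc [DecidableEq α] [DecidableEq β] (M : Matrix α β ℝ)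
    (G : SimpleGraph (α ⊕ β)) (hG : ∀ i k, M i k ≠ 0 → G.Adj (Sum.inl i) (Sum.inr k))
    {γ L : ℝ} (hγ : 0 < γ) (hγL : γ ≤ L)
    (hrow : ∀ i, ∑ k, |M i k| ≤ L) (hcol : ∀ k, ∑ i, |M i k| ≤ L)
    (h : ∀ u : α → ℝ, ∀ v : β → ℝ, (∀ i, u i = 0 ∨ u i = 1) → (∀ j, v j = 0 ∨ v j = 1) →
      (G.induce {x | Sum.elim u v x = 1}).Connected →
      |u ⬝ᵥ (M *ᵥ v)| ≤ γ * Real.sqrt ((∑ i, u i) * (∑ j, v j)))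
    (k : ℕ) :
    ((Matrix.fromBlocks (0 : Matrix α α ℝ) M Mᵀ (0 : Matrix β β ℝ)) ^ (2 * k)).trace
      ≤ (Fintype.card α + Fintype.card β) * (100 * (γ * (Real.logb 2 (L / γ) + 1))) ^ (2 * k) := by
  set A := Matrix.fromBlocks (0 : Matrix α α ℝ) M Mᵀ (0 : Matrix β β ℝ) with hAdef
  -- all 0/1 pairs, then all 0/1 pairs of the double, then rectangles
  have hall := disc_of_connected_pairs M G hG hγ.le h
  have hdisj : ∀ U W : α ⊕ β → ℝ, (∀ x, U x = 0 ∨ U x = 1) → (∀ x, W x = 0 ∨ W x = 1) →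
      (∀ x, U x = 0 ∨ W x = 0) →
      |U ⬝ᵥ (A *ᵥ W)| ≤ γ * Real.sqrt ((∑ x, U x) * (∑ x, W x)) :=
    fun U W hU hW _ => bipartite_disc_of_disc M hγ.le hall U W hU hW
  have hrect := Literature.Combinatorics.Expanders.BiluLinial2006.rectBound_of_forall_dotProduct hdisj
  -- hypotheses of Bilu–Linial 3.3 for the double
  have hsymm : A.IsSymm := fromBlocks_bipartite_isSymm M
  have hrowA : ∀ x, ∑ y, |A x y| ≤ L := by
    intro x
    rw [Fintype.sum_sum_type]
    cases x with
    | inl i => simpa [hAdef, Matrix.fromBlocks_apply₁₁, Matrix.fromBlocks_apply₁₂] using hrow i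
    | inr k => simpa [hAdef, Matrix.fromBlocks_apply₂₁, Matrix.fromBlocks_apply₂₂,
        Matrix.transpose_apply] using hcol k
  have hdiag : ∀ x, |A x x| ≤ 0 * (γ * (Real.logb 2 (L / γ) + 1)) := by
    intro x
    cases x with
    | inl i => simp [hAdef, Matrix.fromBlocks_apply₁₁]
    | inr k => simp [hAdef, Matrix.fromBlocks_apply₂₂]
  have hBL := Literature.Combinatorics.Expanders.BiluLinial2006_lemma_3_3_explicit hsymm hγ hγL
    hrowA hdiag hrect
  have hlog : 0 ≤ Real.logb 2 (L / γ) :=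
    Real.logb_nonneg one_lt_two ((one_le_div hγ).2 hγL)
  have hρ : 0 < 100 * (γ * (Real.logb 2 (L / γ) + 1)) := by positivity
  have hR : ∀ y : α ⊕ β → ℝ, |y ⬝ᵥ (A *ᵥ y)| ≤ 100 * (γ * (Real.logb 2 (L / γ) + 1)) * (y ⬝ᵥ y) := by
    intro y
    have := hBL y
    norm_num at this
    exact this
  have ht := trace_pow_le_of_rayleigh A hsymm hρ hR k
  simpa [Fintype.card_sum] using ht

end Summit.PneNP.PneNP.Theorems.SfmBl
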